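import Mathlib.Algebra.MvPolynomial.Funext
import Mathlib.Algebra.Ring.GeomSum
import Literature.Computability.AlgebraicComplexity.HomogeneousComponentsComplexity
import Literature.Computability.AlgebraicComplexity.IMMInVPProofs
import Literature.Computability.AlgebraicComplexity.RazElusiveGeneralRouteProofs
import Literature.Barriers.ValiantsHypothesis.BDGIL24WeightProjectionProofs
import HarnessLib

/-!
# Strassen's division elimination, one final division: `L(f) ≤ poly(L(f·h), L(h), deg f, #vars)`

V. Strassen, *Vermeidung von Divisionen*, J. reine angew. Math. 264 (1973) 184–202;
P. Bürgisser, M. Clausen, M. A. Shokrollahi, *Algebraic Complexity Theory* (1997), Thm. (7.1)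
("Vermeidung von Divisionen") — here in the special case that is consumed by the
subtraction-free / monotone-with-division normal form `f = g / h` (Fomin–Grigoriev–Koshevoy 2016,
Hrubeš–Yehudayoff 2021 §6): if a POLYNOMIAL `f` of total degree `≤ D` in `N` variables over an
infinite field satisfies `f · h = g` with `h ≠ 0`, then

  `L(f) ≤ (D + 2)² · (L(g) + L(h) + (D + 1)² + 2N + 5) + (D + 1) + N`

(`complexity_le_of_mul_eq`; coarse form `L(f) ≤ (L(g) + L(h) + D + N + 4)⁴`,
`complexity_le_pow_four_of_mul_eq`), for the tree's fan-in-two measure `complexity`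
(`ArithCircuit.lean`, constants free).

## Proof (Strassen's, for a single division)

Pick `a` with `h(a) ≠ 0` (infinite field, `MvPolynomial.funext`) and shift `x ↦ x + a`
(cost `N` both ways, `complexity_aeval_le`); now `c := h(0) ≠ 0`.  Put `u := 1 - c⁻¹ h`
(no constant term) and `S := Σ_{j ≤ D} u^j`.  Then `c⁻¹ · g · S = f · (1 - u) · S = f - f·u^{D+1}`
exactly (`mul_neg_geom_sum`), and every monomial of `f · u^{D+1}` has degree `≥ D + 1`; so the sum of
the homogeneous components of degrees `≤ D` of `c⁻¹ g S` IS `f` (`truncation_eq`).  The cost of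
that truncation is `(D + 2)² · L(c⁻¹ g S) + (D + 1)` by the tree's one-pass homogenisation
`complexity_sum_homogeneousComponent_le` (BCS Lemma (21.25)); `L(S) ≤ (D + 1)² + L(u)` by
substituting `u` into the univariate `Σ_{j ≤ D} X^j`.  No power series are needed.

Everything is PROVED (no named facts, no new definitions).  Honest framing: circuit-model
bookkeeping; consumed by `Summits/ValiantsHypothesis/.../Theorems/FifoMatchingNNDivisionHardOfGeneralHardness.lean`
(general hardness of `NN_n` implies its division hardness).  Nothing here bears on `VP ≠ VNP`.

## References

* [Strassen1973] V. Strassen, *Vermeidung von Divisionen*, J. reine angew. Math. 264 (1973)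
  184–202, Satz 1 / Kor. (the polynomial case).
* [BurgisserClausenShokrollahi1997] P. Bürgisser, M. Clausen, M. A. Shokrollahi, *Algebraic
  Complexity Theory*, Springer 1997, Thm. (7.1) and Lemma (21.25).
* [Burgisser2000] P. Bürgisser, *Completeness and Reduction in Algebraic Complexity Theory*,
  Def. 2.1 (the circuit model).
-/

noncomputable section

namespace Literature.Computability.AlgebraicComplexity

namespace DivisionElimination

open MvPolynomial
open scoped BigOperators

universe u v

/-! ### Degree lower bounds of supports (semiring level) -/

section MinDegree

variable {k : Type u} [CommSemiring k] {σ : Type v}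

/-- If every monomial of `φ` has degree `≥ j` and `e < j`, the degree-`e` homogeneous component of
`φ` vanishes. [folklore] -/
private theorem homogeneousComponent_eq_zero_of_le_degree {φ : MvPolynomial σ k} {j e : ℕ}
    (hφ : ∀ d ∈ φ.support, j ≤ d.degree) (he : e < j) : homogeneousComponent e φ = 0 :=
  homogeneousComponent_eq_zero' e φ fun d hd h => by have := hφ d hd; omega

/-- Degree lower bounds add under products: monomials of `p * q` are sums of monomials of `p`
and of `q` (`MvPolynomial.support_mul`). [folklore] -/
private theorem le_degree_of_mem_support_mul [DecidableEq σ] {p q : MvPolynomial σ k} {a b : ℕ}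
    (hp : ∀ d ∈ p.support, a ≤ d.degree) (hq : ∀ d ∈ q.support, b ≤ d.degree) :
    ∀ d ∈ (p * q).support, a + b ≤ d.degree := by
  intro d hd
  obtain ⟨d₁, hd₁, d₂, hd₂, rfl⟩ := Finset.mem_add.mp (support_mul p q hd)
  rw [map_add]
  exact Nat.add_le_add (hp _ hd₁) (hq _ hd₂)

/-- Degree lower bounds multiply under powers. [folklore] -/
private theorem le_degree_of_mem_support_pow [DecidableEq σ] {p : MvPolynomial σ k} {a : ℕ}
    (hp : ∀ d ∈ p.support, a ≤ d.degree) :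
    ∀ m : ℕ, ∀ d ∈ (p ^ m).support, m * a ≤ d.degree := by
  intro m
  induction m with
  | zero => intro d _; simp
  | succ m ih =>
    intro d hd
    rw [pow_succ] at hd
    have h := le_degree_of_mem_support_mul ih hp d hd
    simpa [Nat.succ_mul] using h

/-- A polynomial without constant term has only monomials of degree `≥ 1`. [folklore] -/
private theorem one_le_degree_of_constantCoeff_eq_zero {u : MvPolynomial σ k}
    (hu : constantCoeff u = 0) : ∀ d ∈ u.support, 1 ≤ d.degree := by
  intro d hd
  rcases Nat.eq_zero_or_pos d.degree with h | h
  · exfalso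
    have hd0 : d = 0 := (Finsupp.degree_eq_zero_iff d).mp h
    subst hd0
    rw [mem_support_iff] at hd
    apply hd
    have : coeff 0 u = constantCoeff u := by rw [constantCoeff_eq]
    rw [this, hu]
  · exact h

/-- All homogeneous components of degree `≤ D` of `f · u^{D+1}` vanish when `u` has no constant
term. [folklore] -/
private theorem sum_homogeneousComponent_mul_pow_eq_zero [DecidableEq σ] (f : MvPolynomial σ k)
    {u : MvPolynomial σ k} (hu : constantCoeff u = 0) (D : ℕ) :
    ∑ e ∈ Finset.range (D + 1), homogeneousComponent e (f * u ^ (D + 1)) = 0 := by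
  refine Finset.sum_eq_zero fun e he => ?_
  have hf : ∀ d ∈ f.support, 0 ≤ d.degree := fun _ _ => Nat.zero_le _
  have hpow := le_degree_of_mem_support_pow (one_le_degree_of_constantCoeff_eq_zero hu) (D + 1)
  have hmul := le_degree_of_mem_support_mul hf hpow
  refine homogeneousComponent_eq_zero_of_le_degree hmul ?_
  rw [Finset.mem_range] at he
  omega

/-- The sum of the homogeneous components of degrees `≤ D` of `f` is `f` once `deg f ≤ D`
(`MvPolynomial.sum_homogeneousComponent` padded with zero components). [folklore] -/
private theorem sum_homogeneousComponent_eq_of_totalDegree_le (f : MvPolynomial σ k) {D : ℕ}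
    (hD : f.totalDegree ≤ D) :
    ∑ e ∈ Finset.range (D + 1), homogeneousComponent e f = f := by
  conv_rhs => rw [← sum_homogeneousComponent f]
  symm
  refine Finset.sum_subset (Finset.range_mono (by omega)) fun e he hne => ?_
  apply homogeneousComponent_eq_zero
  rw [Finset.mem_range] at he hne
  omega

end MinDegree

/-! ### The algebraic identity (field level) -/

section Field

variable {K : Type u} [Field K] {σ : Type v}

/-- **The truncation identity.**  If `f · h = g`, `h(0) = c ≠ 0`, `u := 1 - c⁻¹ • h` and
`deg f ≤ D`, then the homogeneous components of degrees `≤ D` of `c⁻¹ • (g · Σ_{j ≤ D} u^j)` sum to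
`f`: indeed `c⁻¹ g Σ u^j = f (1 - u) Σ_{j ≤ D} u^j = f - f u^{D+1}` and `f u^{D+1}` lives in degrees
`> D` (Strassen 1973; BCS 1997 Thm. (7.1), proof). [cite: BurgisserClausenShokrollahi1997, Thm. (7.1)] -/
theorem truncation_eq [DecidableEq σ] {f g h : MvPolynomial σ K} (hfh : f * h = g) {c : K}
    (hc : constantCoeff h = c) (hc0 : c ≠ 0) {D : ℕ} (hD : f.totalDegree ≤ D) :
    ∑ e ∈ Finset.range (D + 1), homogeneousComponent e
        (c⁻¹ • (g * ∑ j ∈ Finset.range (D + 1), (1 - c⁻¹ • h) ^ j)) = f := by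
  set u : MvPolynomial σ K := 1 - c⁻¹ • h with hu
  have hu0 : constantCoeff u = 0 := by
    rw [hu, map_sub, map_one]
    rw [smul_eq_C_mul, map_mul, constantCoeff_C, hc, inv_mul_cancel₀ hc0, sub_self]
  have key : c⁻¹ • (g * ∑ j ∈ Finset.range (D + 1), u ^ j) = f - f * u ^ (D + 1) := by
    have h1 : (c⁻¹ • h : MvPolynomial σ K) = 1 - u := by rw [hu, sub_sub_cancel]
    calc c⁻¹ • (g * ∑ j ∈ Finset.range (D + 1), u ^ j)
        = f * ((c⁻¹ • h) * ∑ j ∈ Finset.range (D + 1), u ^ j) := by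
          rw [← hfh, smul_eq_C_mul, smul_eq_C_mul]; ring
      _ = f * (1 - u ^ (D + 1)) := by rw [h1, mul_neg_geom_sum]
      _ = f - f * u ^ (D + 1) := by ring
  rw [key, Finset.sum_congr rfl fun e _ => map_sub (homogeneousComponent e) _ _,
    Finset.sum_sub_distrib, sum_homogeneousComponent_mul_pow_eq_zero f hu0 D, sub_zero,
    sum_homogeneousComponent_eq_of_totalDegree_le f hD]

/-- Evaluation commutes with substitution (`eval x (f(τ)) = f(eval x ∘ τ)`). [folklore] -/
private theorem eval_aeval_eq' {τ : Type*} (x : τ → K) (e : σ → MvPolynomial τ K)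
    (p : MvPolynomial σ K) : eval x (aeval e p) = eval (fun i => eval x (e i)) p := by
  induction p using MvPolynomial.induction_on with
  | C a => simp
  | add p q hp hq => rw [map_add, map_add, hp, hq, map_add]
  | mul_X p i hp => rw [map_mul, map_mul, hp, aeval_X, map_mul, eval_X]

/-- The constant term after the shift `x ↦ x + a` is the value at `a`. [folklore] -/
private theorem constantCoeff_aeval_X_add_C (a : σ → K) (p : MvPolynomial σ K) :
    constantCoeff (aeval (fun i => X i + C (a i)) p) = eval a p := by
  rw [← eval_zero', eval_aeval_eq']
  have e : (fun i => eval (fun _ => (0 : K)) (X i + C (a i))) = a := by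
    funext i
    simp
  rw [e]

/-- Shifting back: `(x ↦ x - a) ∘ (x ↦ x + a) = id` on polynomials. [folklore] -/
private theorem aeval_X_sub_C_aeval_X_add_C (a : σ → K) (p : MvPolynomial σ K) :
    aeval (fun i => X i + C (-a i)) (aeval (fun i => X i + C (a i)) p) = p := by
  rw [← AlgHom.comp_apply, comp_aeval]
  have : (fun i => aeval (R := K) (fun i => X i + C (-a i)) (X i + C (a i))) =
      (X : σ → MvPolynomial σ K) := by
    funext i
    rw [map_add, aeval_X, aeval_C, algebraMap_eq, C_neg, neg_add_cancel_right]
  rw [this, aeval_X_left, AlgHom.id_apply]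

/-- Over an infinite field a nonzero polynomial has a non-root. [folklore] -/
private theorem exists_eval_ne_zero [Infinite K] {h : MvPolynomial σ K} (hh : h ≠ 0) :
    ∃ a : σ → K, eval a h ≠ 0 := by
  by_contra hall
  push Not at hall
  exact hh (MvPolynomial.funext fun x => by rw [hall x, map_zero])

end Field

/-! ### Complexity bookkeeping -/

section Cost

variable {K : Type u} [Field K] {σ : Type v}

/-- `L(x_i + a) ≤ 1`. [cite: Burgisser2000, Def. 2.1] -/
theorem complexity_X_add_C_le (i : σ) (a : K) :
    complexity (X i + C a : MvPolynomial σ K) ≤ 1 := by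
  have h := complexity_add_le_holds (X i : MvPolynomial σ K) (C a)
  rw [complexity_X_holds, complexity_C_holds] at h
  simpa using h

/-- A shift `x ↦ x + a` costs at most one gate per variable: `L(f(x + a)) ≤ L(f) + N`.
[cite: Burgisser2000, Rem. 2.7] -/
theorem complexity_shift_le [Fintype σ] (f : MvPolynomial σ K) (a : σ → K) :
    complexity (aeval (fun i => X i + C (a i)) f) ≤ complexity f + Fintype.card σ := by
  refine (complexity_aeval_le f _).trans (Nat.add_le_add_left ?_ _)
  calc ∑ i, complexity (X i + C (a i) : MvPolynomial σ K) ≤ ∑ _i : σ, 1 :=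
        Finset.sum_le_sum fun i _ => complexity_X_add_C_le i (a i)
    _ = Fintype.card σ := by simp

/-- `L(1 - c • h) ≤ L(h) + 3`. [cite: Burgisser2000, Def. 2.1] -/
theorem complexity_one_sub_smul_le (c : K) (h : MvPolynomial σ K) :
    complexity (1 - c • h) ≤ complexity h + 3 := by
  have e : (1 - c • h : MvPolynomial σ K) = C 1 + (-1 : K) • (c • h) := by
    rw [neg_one_smul, C_1, sub_eq_add_neg]
  rw [e]
  have h1 := complexity_add_le_holds (C (1 : K) : MvPolynomial σ K) ((-1 : K) • (c • h))
  have h2 := complexity_smul_le_holds (σ := σ) (-1 : K) (c • h)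
  have h3 := complexity_smul_le_holds (σ := σ) c h
  rw [complexity_C_holds] at h1
  omega

/-- Powers of a variable: `L(X^j) ≤ j`. [cite: Burgisser2000, Def. 2.1] -/
theorem complexity_X_pow_le' {τ : Type*} (i : τ) (j : ℕ) :
    complexity ((X i : MvPolynomial τ K) ^ j) ≤ j := by
  induction j with
  | zero =>
    rw [pow_zero]
    have h := complexity_C_holds (σ := τ) (1 : K)
    rw [C_1] at h
    omega
  | succ j ih =>
    rw [pow_succ]
    have h := complexity_mul_le_holds ((X i : MvPolynomial τ K) ^ j) (X i)
    rw [complexity_X_holds] at h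
    omega

/-- The univariate geometric polynomial `Σ_{j ≤ D} X^j` costs at most `(D + 1)²` gates.
[cite: Burgisser2000, Def. 2.1] -/
theorem complexity_univariate_geom_le (D : ℕ) :
    complexity (∑ j ∈ Finset.range (D + 1), (X () : MvPolynomial Unit K) ^ j) ≤ (D + 1) ^ 2 := by
  refine (complexity_finset_sum_le _ _).trans ?_
  rw [Finset.card_range]
  have : ∑ j ∈ Finset.range (D + 1), complexity ((X () : MvPolynomial Unit K) ^ j) ≤
      ∑ _j ∈ Finset.range (D + 1), D :=
    Finset.sum_le_sum fun j hj => (complexity_X_pow_le' () j).trans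
      (by rw [Finset.mem_range] at hj; omega)
  refine (Nat.add_le_add_right this _).trans ?_
  rw [Finset.sum_const, Finset.card_range, smul_eq_mul]
  nlinarith

/-- `L(Σ_{j ≤ D} u^j) ≤ (D + 1)² + L(u)` (substitute `u` into the univariate geometric
polynomial). [cite: Burgisser2000, Rem. 2.7] -/
theorem complexity_geom_sum_le (u : MvPolynomial σ K) (D : ℕ) :
    complexity (∑ j ∈ Finset.range (D + 1), u ^ j) ≤ (D + 1) ^ 2 + complexity u := by
  have h := complexity_aeval_le (∑ j ∈ Finset.range (D + 1), (X () : MvPolynomial Unit K) ^ j)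
    (fun _ : Unit => u)
  rw [map_sum] at h
  simp only [map_pow, aeval_X] at h
  refine h.trans ?_
  rw [Fintype.sum_unique]
  exact Nat.add_le_add_right (complexity_univariate_geom_le D) _

/-- **Strassen's division elimination (one final division, polynomial quotient).**  Over an
infinite field, if `f · h = g` with `h ≠ 0` and `deg f ≤ D` (`N = #variables`), then
`L(f) ≤ (D + 2)² · (L(g) + L(h) + (D + 1)² + 2N + 5) + (D + 1) + N`
(Strassen 1973; BCS 1997 Thm. (7.1), the case of a single division).
[cite: BurgisserClausenShokrollahi1997, Thm. (7.1)] -/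
theorem complexity_le_of_mul_eq [Infinite K] [Fintype σ] [DecidableEq σ]
    {f g h : MvPolynomial σ K} (hfh : f * h = g) (hh : h ≠ 0) {D : ℕ}
    (hD : f.totalDegree ≤ D) :
    complexity f ≤ (D + 2) ^ 2 *
        (complexity g + complexity h + (D + 1) ^ 2 + 2 * Fintype.card σ + 5) +
      (D + 1) + Fintype.card σ := by
  obtain ⟨a, ha⟩ := exists_eval_ne_zero hh
  set τ : σ → MvPolynomial σ K := fun i => X i + C (a i) with hτ
  set f' := aeval τ f with hf'
  set g' := aeval τ g with hg'
  set h' := aeval τ h with hh'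
  set c : K := eval a h with hcdef
  have hfh' : f' * h' = g' := by rw [hf', hh', hg', ← map_mul, hfh]
  have hc : constantCoeff h' = c := constantCoeff_aeval_X_add_C a h
  have hD' : f'.totalDegree ≤ D := by
    refine le_trans (Literature.Barriers.ValiantsHypothesis.BergEtAl2024.totalDegree_aeval_le_of_forall_le_one
      f (θ := τ) fun i => ?_) hD
    refine (totalDegree_add _ _).trans (max_le ?_ ?_)
    · exact (totalDegree_X (R := K) i).le
    · rw [totalDegree_C]; exact Nat.zero_le _
  -- the truncation `T` of `c⁻¹ • (g' * S)` is `f'`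
  set S : MvPolynomial σ K := ∑ j ∈ Finset.range (D + 1), (1 - c⁻¹ • h') ^ j with hS
  set G : MvPolynomial σ K := c⁻¹ • (g' * S) with hG
  have hT : ∑ e ∈ Finset.range (D + 1), homogeneousComponent e G = f' :=
    truncation_eq hfh' hc ha hD'
  -- costs
  have cg' : complexity g' ≤ complexity g + Fintype.card σ := complexity_shift_le g a
  have ch' : complexity h' ≤ complexity h + Fintype.card σ := complexity_shift_le h a
  have cu : complexity (1 - c⁻¹ • h') ≤ complexity h' + 3 := complexity_one_sub_smul_le _ _
  have cS : complexity S ≤ (D + 1) ^ 2 + complexity (1 - c⁻¹ • h') :=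
    complexity_geom_sum_le _ D
  have cG : complexity G ≤ complexity g' + complexity S + 2 := by
    have h1 := complexity_smul_le_holds (σ := σ) c⁻¹ (g' * S)
    have h2 := complexity_mul_le_holds g' S
    rw [hG]; omega
  have cT := complexity_sum_homogeneousComponent_le G D
  rw [hT] at cT
  have cf : complexity f ≤ complexity f' + Fintype.card σ := by
    have e : f = aeval (fun i => X i + C (-a i)) f' := by
      rw [hf', aeval_X_sub_C_aeval_X_add_C]
    rw [e]
    exact complexity_shift_le f' _
  have cG' : complexity G ≤
      complexity g + complexity h + (D + 1) ^ 2 + 2 * Fintype.card σ + 5 := by omega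
  calc complexity f ≤ complexity f' + Fintype.card σ := cf
    _ ≤ (D + 2) ^ 2 * complexity G + (D + 1) + Fintype.card σ := by omega
    _ ≤ (D + 2) ^ 2 * (complexity g + complexity h + (D + 1) ^ 2 + 2 * Fintype.card σ + 5) +
          (D + 1) + Fintype.card σ := by
        have := Nat.mul_le_mul_left ((D + 2) ^ 2) cG'
        omega

/-- Coarse form of `complexity_le_of_mul_eq`: `L(f) ≤ (L(g) + L(h) + D + N + 4)⁴`.
[cite: BurgisserClausenShokrollahi1997, Thm. (7.1)] -/
theorem complexity_le_pow_four_of_mul_eq [Infinite K] [Fintype σ] [DecidableEq σ]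
    {f g h : MvPolynomial σ K} (hfh : f * h = g) (hh : h ≠ 0) {D : ℕ}
    (hD : f.totalDegree ≤ D) :
    complexity f ≤ (complexity g + complexity h + D + Fintype.card σ + 4) ^ 4 := by
  have h0 := complexity_le_of_mul_eq hfh hh hD
  set A := complexity g + complexity h with hA
  set N := Fintype.card σ with hN
  set M := A + D + N + 4 with hM
  have h1 : (D + 2) ^ 2 ≤ M ^ 2 := Nat.pow_le_pow_left (by omega) 2
  have h2 : A + (D + 1) ^ 2 + 2 * N + 5 + (D + 1 + N) ≤ M ^ 2 := by
    rw [hM]; nlinarith [Nat.zero_le A, Nat.zero_le N, Nat.zero_le D]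
  have h3 : (D + 2) ^ 2 * (A + (D + 1) ^ 2 + 2 * N + 5) + (D + 1) + N ≤
      (D + 2) ^ 2 * (A + (D + 1) ^ 2 + 2 * N + 5 + (D + 1 + N)) := by
    have hsq : 1 ≤ (D + 2) ^ 2 := Nat.one_le_pow _ _ (by omega)
    nlinarith
  calc complexity f ≤ (D + 2) ^ 2 * (A + (D + 1) ^ 2 + 2 * N + 5) + (D + 1) + N := h0
    _ ≤ (D + 2) ^ 2 * (A + (D + 1) ^ 2 + 2 * N + 5 + (D + 1 + N)) := h3
    _ ≤ M ^ 2 * M ^ 2 := Nat.mul_le_mul h1 h2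
    _ = M ^ 4 := by ring

end Cost

end DivisionElimination

end Literature.Computability.AlgebraicComplexity

end
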